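import Mathlib
import Literature.Claims.NS.Moschandreou2021
import Literature.Analysis.FluidPDE.WholeSpaceIBP
import HarnessLib

/-!
# Solo salvage for claim C05 `Moschandreou2021` (cell `ns-claims`, D-0090): the charitable re-typing
# R#1′ of Step 1 — the horizontal field (8) WITHOUT the periodicity conjunct is an EXACT
# Navier–Stokes flow on `ℝ³` (time-dependent linear flow, Craik–Criminale / Drazin Ex. 2.19 criterion)

Claim skeleton: `Literature/Claims/NS/Moschandreou2021.lean` (typist `ns-claims-typist-3`, p465223).
`Step_1` types the printed assertion «a solution exists in the form (4) `u : ℝ⁺ × ℝ³/ℤ³ → ℝ³` whose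
horizontal components are the field (8)» — with the ℤ³-periodicity the printed map carries; that
conjunct is refuted by `ansatzVelocity_apply_zero` (the `x`-component `sin(4t*)x + (cos(4t*)+2)y` is not
periodic). The referee's charitable re-typing R#1′ (`claims/Moschandreou2021/RETYPE.md` §1) DROPS the
periodicity: for every `δ < 0` there are a printed forcing, a viscosity, a third component `u_z` and a
pressure with which the ansatz velocity is a classical forced Navier–Stokes solution on `ℝ³ × [0,∞)`.

This file proves R#1′ outright, with `u_z ≡ 0`, `f ≡ 0` (one of the printed forcings, l.145) and `ν = 1`
(any `ν` works: the field is linear in `x`, so `Δu = 0`): writing `t* = δ²t` and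
`A(t) = [[sin 4t*, cos 4t* + 2], [cos 4t* − 2, −sin 4t*]]` on the horizontal plane, `u = A(t) x_h` has
`div u = sin 4t* − sin 4t* = 0`, `A(t)² = −3·I` and `∂ₜA = 4δ²[[cos, −sin], [−sin, −cos]]`, both SYMMETRIC, so
`∂ₜu + (u·∇)u = (∂ₜA + A²) x_h` is the gradient of `−½⟪x_h, (∂ₜA + A²) x_h⟫`; the pressure
`P(t,x) = −½⟪x, B(t) x⟫`, `B(t) = 4δ² ∂ₜA − 3 Π_h`, closes the momentum equation (Drazin 2002, Ex. 2.19: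
a linear flow `S(t)x` solves Navier–Stokes iff `dS/dt + S²` is symmetric and `trace S = 0`; tree
`Literature.Analysis.FluidPDE.KelvinModeLinearFlow` has the steady case).

Consequence for the adjudication of C05: the object the printed argument treats is a genuine exact
solution OUTSIDE the Clay (B) class (not periodic, infinite energy) — the row's class is «wrong problem»
(Δ4 data class / Δ5 solution class, Δ3 forcing), not a false lemma about fluids.

Solo lane (`Theorems/SoloSalvage<Slug>…lean`, no item). Seat `ns-claims-ref-2` (referee lane 2).

WHAT THIS IS NOT: not a claim about NS regularity or blow-up; not a claim about any author beyond the
typed locator.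
-/

set_option linter.dupNamespace false

open Set Function WithLp
open scoped ContDiff Laplacian InnerProductSpace RealInnerProductSpace

namespace Summit.NavierStokesRegularity.NavierStokesRegularity.Theorems.Moschandreou2021Salvage

open Literature.Analysis.FluidPDE
open Literature.Claims.NS.Moschandreou2021

noncomputable section

/-! ### The four linear building blocks of the field (8) -/

/-- `x ↦ (x₀, −x₁, 0)` (the `sin 4t*` part of (8)). [cite: Moschandreou2021, eq. (8) l.153–159] -/
def vS (x : EuclideanSpace ℝ (Fin 3)) : EuclideanSpace ℝ (Fin 3) := toLp 2 ![x 0, -x 1, 0]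

/-- `x ↦ (x₁, x₀, 0)` (the `cos 4t*` part of (8)). [cite: Moschandreou2021, eq. (8) l.153–159] -/
def vC (x : EuclideanSpace ℝ (Fin 3)) : EuclideanSpace ℝ (Fin 3) := toLp 2 ![x 1, x 0, 0]

/-- `x ↦ (2x₁, −2x₀, 0)` (the constant part of (8)). [cite: Moschandreou2021, eq. (8) l.153–159] -/
def vK (x : EuclideanSpace ℝ (Fin 3)) : EuclideanSpace ℝ (Fin 3) := toLp 2 ![2 * x 1, -2 * x 0, 0]

/-- `x ↦ (x₀, x₁, 0)` (the horizontal projection). [folklore] -/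
def vH (x : EuclideanSpace ℝ (Fin 3)) : EuclideanSpace ℝ (Fin 3) := toLp 2 ![x 0, x 1, 0]

/-- The first component of `vS`. [folklore] -/
@[simp] theorem vS_apply_zero (x : EuclideanSpace ℝ (Fin 3)) : vS x 0 = x 0 := rfl
/-- The second component of `vS`. [folklore] -/
@[simp] theorem vS_apply_one (x : EuclideanSpace ℝ (Fin 3)) : vS x 1 = -x 1 := rfl
/-- The third component of `vS`. [folklore] -/
@[simp] theorem vS_apply_two (x : EuclideanSpace ℝ (Fin 3)) : vS x 2 = 0 := rfl
/-- The first component of `vC`. [folklore] -/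
@[simp] theorem vC_apply_zero (x : EuclideanSpace ℝ (Fin 3)) : vC x 0 = x 1 := rfl
/-- The second component of `vC`. [folklore] -/
@[simp] theorem vC_apply_one (x : EuclideanSpace ℝ (Fin 3)) : vC x 1 = x 0 := rfl
/-- The third component of `vC`. [folklore] -/
@[simp] theorem vC_apply_two (x : EuclideanSpace ℝ (Fin 3)) : vC x 2 = 0 := rfl
/-- The first component of `vK`. [folklore] -/
@[simp] theorem vK_apply_zero (x : EuclideanSpace ℝ (Fin 3)) : vK x 0 = 2 * x 1 := rfl
/-- The second component of `vK`. [folklore] -/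
@[simp] theorem vK_apply_one (x : EuclideanSpace ℝ (Fin 3)) : vK x 1 = -2 * x 0 := rfl
/-- The third component of `vK`. [folklore] -/
@[simp] theorem vK_apply_two (x : EuclideanSpace ℝ (Fin 3)) : vK x 2 = 0 := rfl
/-- The first component of `vH`. [folklore] -/
@[simp] theorem vH_apply_zero (x : EuclideanSpace ℝ (Fin 3)) : vH x 0 = x 0 := rfl
/-- The second component of `vH`. [folklore] -/
@[simp] theorem vH_apply_one (x : EuclideanSpace ℝ (Fin 3)) : vH x 1 = x 1 := rfl
/-- The third component of `vH`. [folklore] -/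
@[simp] theorem vH_apply_two (x : EuclideanSpace ℝ (Fin 3)) : vH x 2 = 0 := rfl

/-- `vS` as a continuous linear map. [folklore] -/
def vSL : EuclideanSpace ℝ (Fin 3) →L[ℝ] EuclideanSpace ℝ (Fin 3) :=
  LinearMap.toContinuousLinearMap
    { toFun := vS
      map_add' := fun v w => by ext i; fin_cases i <;> (simp [vS]; try ring)
      map_smul' := fun c v => by ext i; fin_cases i <;> (simp [vS]; try ring) }

/-- `vC` as a continuous linear map. [folklore] -/
def vCL : EuclideanSpace ℝ (Fin 3) →L[ℝ] EuclideanSpace ℝ (Fin 3) :=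
  LinearMap.toContinuousLinearMap
    { toFun := vC
      map_add' := fun v w => by ext i; fin_cases i <;> (simp [vC]; try ring)
      map_smul' := fun c v => by ext i; fin_cases i <;> (simp [vC]; try ring) }

/-- `vK` as a continuous linear map. [folklore] -/
def vKL : EuclideanSpace ℝ (Fin 3) →L[ℝ] EuclideanSpace ℝ (Fin 3) :=
  LinearMap.toContinuousLinearMap
    { toFun := vK
      map_add' := fun v w => by ext i; fin_cases i <;> (simp [vK]; try ring)
      map_smul' := fun c v => by ext i; fin_cases i <;> (simp [vK]; try ring) }

/-- `vH` as a continuous linear map. [folklore] -/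
def vHL : EuclideanSpace ℝ (Fin 3) →L[ℝ] EuclideanSpace ℝ (Fin 3) :=
  LinearMap.toContinuousLinearMap
    { toFun := vH
      map_add' := fun v w => by ext i; fin_cases i <;> (simp [vH]; try ring)
      map_smul' := fun c v => by ext i; fin_cases i <;> (simp [vH]; try ring) }

/-- The continuous linear map `vSL` is `vS`. [folklore] -/
@[simp] theorem vSL_apply (x : EuclideanSpace ℝ (Fin 3)) : vSL x = vS x := rfl
/-- The continuous linear map `vCL` is `vC`. [folklore] -/
@[simp] theorem vCL_apply (x : EuclideanSpace ℝ (Fin 3)) : vCL x = vC x := rfl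
/-- The continuous linear map `vKL` is `vK`. [folklore] -/
@[simp] theorem vKL_apply (x : EuclideanSpace ℝ (Fin 3)) : vKL x = vK x := rfl
/-- The continuous linear map `vHL` is `vH`. [folklore] -/
@[simp] theorem vHL_apply (x : EuclideanSpace ℝ (Fin 3)) : vHL x = vH x := rfl

/-- The horizontal matrix `A` of (8) at the phase `(s, c) = (sin 4t*, cos 4t*)`:
`A x = (s x₀ + (c+2) x₁, (c−2) x₀ − s x₁, 0)`. [cite: Moschandreou2021, eq. (8) l.153–159] -/
def linA (s c : ℝ) : EuclideanSpace ℝ (Fin 3) →L[ℝ] EuclideanSpace ℝ (Fin 3) :=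
  s • vSL + c • vCL + vKL

/-- `∂ₜA / (4δ²)` at the phase `(s, c)`: `x ↦ (c x₀ − s x₁, −s x₀ − c x₁, 0)`. [folklore] -/
def linD (s c : ℝ) : EuclideanSpace ℝ (Fin 3) →L[ℝ] EuclideanSpace ℝ (Fin 3) :=
  c • vSL - s • vCL

/-- `B(t) = 4δ² ∂ₜA/(4δ²) − 3 Π_h = ∂ₜA + A²` (using `A² = −3 Π_h`). [folklore] -/
def projB (δ s c : ℝ) : EuclideanSpace ℝ (Fin 3) →L[ℝ] EuclideanSpace ℝ (Fin 3) :=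
  (4 * δ ^ 2) • linD s c + (-3 : ℝ) • vHL

/-- The pressure `P(t, x) = −½⟪x, B(t) x⟫`. [cite: Drazin2002, Ex. 2.19] -/
def pres (δ t : ℝ) (x : EuclideanSpace ℝ (Fin 3)) : ℝ :=
  -2⁻¹ * ⟪x, projB δ (Real.sin (4 * (δ ^ 2 * t))) (Real.cos (4 * (δ ^ 2 * t))) x⟫

/-! ### Algebra of the blocks -/

/-- The ansatz velocity with `u_z ≡ 0` in terms of the blocks. [cite: Moschandreou2021, eq. (8) l.153–159] -/
theorem ansatz_eq (δ t : ℝ) (x : EuclideanSpace ℝ (Fin 3)) :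
    ansatzVelocity δ (fun _ _ => 0) t x =
      Real.sin (4 * (δ ^ 2 * t)) • vS x + Real.cos (4 * (δ ^ 2 * t)) • vC x + vK x := by
  ext i; fin_cases i <;> simp [ansatzVelocity, vS, vC, vK] <;> ring

/-- The time slice of the ansatz velocity (`u_z ≡ 0`) is the linear map `linA`. [folklore] -/
theorem ansatz_slice_eq (δ t : ℝ) :
    ansatzVelocity δ (fun _ _ => 0) t =
      ⇑(linA (Real.sin (4 * (δ ^ 2 * t))) (Real.cos (4 * (δ ^ 2 * t)))) := by
  funext x
  rw [ansatz_eq]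
  simp [linA]

/-- `A² = −3 Π_h` when `s² + c² = 1`. [folklore] -/
theorem linA_sq (s c : ℝ) (h : s ^ 2 + c ^ 2 = 1) (x : EuclideanSpace ℝ (Fin 3)) :
    linA s c (linA s c x) = (-3 : ℝ) • vH x := by
  ext i; fin_cases i <;> simp [linA, vS, vC, vK, vH]
  · linear_combination (x 0) * h
  · linear_combination (x 1) * h

/-- `B(t)` is symmetric. [folklore] -/
theorem projB_symm (δ s c : ℝ) (x y : EuclideanSpace ℝ (Fin 3)) :
    ⟪projB δ s c x, y⟫ = ⟪x, projB δ s c y⟫ := by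
  simp [projB, linD, vS, vC, vH, PiLp.inner_apply, Fin.sum_univ_three]
  ring

/-- Gradient of the quadratic form `−½⟪x, B x⟫` of a symmetric `B`: `−B x`. [cite: Drazin2002, Ex. 2.19] -/
theorem hasGradientAt_quadratic (B : EuclideanSpace ℝ (Fin 3) →L[ℝ] EuclideanSpace ℝ (Fin 3))
    (hB : ∀ x y, ⟪B x, y⟫ = ⟪x, B y⟫) (x : EuclideanSpace ℝ (Fin 3)) :
    HasGradientAt (fun y => -2⁻¹ * ⟪y, B y⟫) (-(B x)) x := by
  rw [hasGradientAt_iff_hasFDerivAt]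
  have h : HasFDerivAt (fun y : EuclideanSpace ℝ (Fin 3) => ⟪id y, B y⟫) _ x :=
    (hasFDerivAt_id x).inner ℝ B.hasFDerivAt
  refine (h.const_mul (-2⁻¹ : ℝ)).congr_fderiv ?_
  ext v
  have e1 : ⟪x, B v⟫ = ⟪B x, v⟫ := (hB x v).symm
  have e2 : ⟪v, B x⟫ = ⟪B x, v⟫ := real_inner_comm _ _
  simp [e1, e2]
  ring

/-- `∇P(t, ·)(x) = −B(t) x`. [cite: Drazin2002, Ex. 2.19] -/
theorem gradient_pres (δ t : ℝ) (x : EuclideanSpace ℝ (Fin 3)) :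
    gradient (pres δ t) x =
      -(projB δ (Real.sin (4 * (δ ^ 2 * t))) (Real.cos (4 * (δ ^ 2 * t))) x) :=
  (hasGradientAt_quadratic _ (projB_symm δ _ _) x).gradient

/-- The Laplacian of a continuous linear map vanishes. [folklore] -/
theorem laplacian_clm (L : EuclideanSpace ℝ (Fin 3) →L[ℝ] EuclideanSpace ℝ (Fin 3))
    (x : EuclideanSpace ℝ (Fin 3)) : Δ (fun y => L y) x = 0 := by
  rw [laplacian_eq_sum_fderiv_fderiv (stdOrthonormalBasis ℝ (EuclideanSpace ℝ (Fin 3))) L.contDiff x]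
  refine Finset.sum_eq_zero fun i _ => ?_
  have h : (fun y => fderiv ℝ (fun y => L y) y (stdOrthonormalBasis ℝ (EuclideanSpace ℝ (Fin 3)) i)) =
      fun _ => L (stdOrthonormalBasis ℝ (EuclideanSpace ℝ (Fin 3)) i) := by
    funext y; rw [L.fderiv]
  rw [h]
  simp

/-- `div (A x) = trace A = s − s = 0`. [cite: Moschandreou2021, eq. (8) l.153–159] -/
theorem isDivFree_linA (s c : ℝ) : VectorCalculus.IsDivFree (fun y => linA s c y) := by
  intro x
  rw [divergence_eq_sum_inner_fderiv (EuclideanSpace.basisFun (Fin 3) ℝ), (linA s c).fderiv]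
  simp [Fin.sum_univ_three, EuclideanSpace.inner_single_left, linA, vS, vC, vK]

/-! ### The time derivative -/

/-- `d/dt [4(δ²t)] = 4δ²`. [folklore] -/
theorem hasDerivAt_phase (δ t : ℝ) : HasDerivAt (fun τ => 4 * (δ ^ 2 * τ)) (4 * δ ^ 2) t := by
  simpa using ((hasDerivAt_id t).const_mul (δ ^ 2)).const_mul 4

/-- `∂ₜ u = 4δ² · linD(sin, cos) x`. [folklore] -/
theorem hasDerivAt_ansatz (δ t : ℝ) (x : EuclideanSpace ℝ (Fin 3)) :
    HasDerivAt (fun τ => ansatzVelocity δ (fun _ _ => 0) τ x)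
      ((4 * δ ^ 2) • linD (Real.sin (4 * (δ ^ 2 * t))) (Real.cos (4 * (δ ^ 2 * t))) x) t := by
  have hsin : HasDerivAt (fun τ => Real.sin (4 * (δ ^ 2 * τ)))
      (Real.cos (4 * (δ ^ 2 * t)) * (4 * δ ^ 2)) t :=
    (Real.hasDerivAt_sin _).comp t (hasDerivAt_phase δ t)
  have hcos : HasDerivAt (fun τ => Real.cos (4 * (δ ^ 2 * τ)))
      (-Real.sin (4 * (δ ^ 2 * t)) * (4 * δ ^ 2)) t :=
    (Real.hasDerivAt_cos _).comp t (hasDerivAt_phase δ t)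
  have h := ((hsin.smul_const (vS x)).add (hcos.smul_const (vC x))).add_const (vK x)
  have hfun : (fun τ => ansatzVelocity δ (fun _ _ => 0) τ x) =
      fun τ => Real.sin (4 * (δ ^ 2 * τ)) • vS x + Real.cos (4 * (δ ^ 2 * τ)) • vC x + vK x := by
    funext τ; exact ansatz_eq δ τ x
  rw [hfun]
  refine HasDerivAt.congr_deriv h ?_
  ext i; fin_cases i <;> simp [linD, vS, vC] <;> ring

/-! ### Smoothness -/

/-- Joint smoothness of the velocity on `[0,∞) × ℝ³`. [folklore] -/
theorem isSmoothSpaceTimeOn_ansatz (δ : ℝ) :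
    IsSmoothSpaceTimeOn (Ici 0) (ansatzVelocity δ (fun _ _ => 0)) := by
  have hfun : uncurry (ansatzVelocity δ (fun _ _ => 0)) =
      fun p : ℝ × EuclideanSpace ℝ (Fin 3) =>
        Real.sin (4 * (δ ^ 2 * p.1)) • vS p.2 + Real.cos (4 * (δ ^ 2 * p.1)) • vC p.2 + vK p.2 := by
    funext p; exact ansatz_eq δ p.1 p.2
  have hph : ContDiff ℝ ∞ (fun p : ℝ × EuclideanSpace ℝ (Fin 3) => 4 * (δ ^ 2 * p.1)) := by
    fun_prop
  have hsin : ContDiff ℝ ∞ (fun p : ℝ × EuclideanSpace ℝ (Fin 3) => Real.sin (4 * (δ ^ 2 * p.1))) :=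
    Real.contDiff_sin.comp hph
  have hcos : ContDiff ℝ ∞ (fun p : ℝ × EuclideanSpace ℝ (Fin 3) => Real.cos (4 * (δ ^ 2 * p.1))) :=
    Real.contDiff_cos.comp hph
  have hS : ContDiff ℝ ∞ (fun p : ℝ × EuclideanSpace ℝ (Fin 3) => vS p.2) :=
    vSL.contDiff.comp contDiff_snd
  have hC : ContDiff ℝ ∞ (fun p : ℝ × EuclideanSpace ℝ (Fin 3) => vC p.2) :=
    vCL.contDiff.comp contDiff_snd
  have hK : ContDiff ℝ ∞ (fun p : ℝ × EuclideanSpace ℝ (Fin 3) => vK p.2) :=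
    vKL.contDiff.comp contDiff_snd
  unfold IsSmoothSpaceTimeOn
  rw [hfun]
  exact (((hsin.smul hS).add (hcos.smul hC)).add hK).contDiffOn

/-- Joint smoothness of the pressure on `[0,∞) × ℝ³`. [folklore] -/
theorem isSmoothSpaceTimeOn_pres (δ : ℝ) : IsSmoothSpaceTimeOn (Ici 0) (pres δ) := by
  have hph : ContDiff ℝ ∞ (fun p : ℝ × EuclideanSpace ℝ (Fin 3) => 4 * (δ ^ 2 * p.1)) := by
    fun_prop
  have hsin : ContDiff ℝ ∞ (fun p : ℝ × EuclideanSpace ℝ (Fin 3) => Real.sin (4 * (δ ^ 2 * p.1))) :=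
    Real.contDiff_sin.comp hph
  have hcos : ContDiff ℝ ∞ (fun p : ℝ × EuclideanSpace ℝ (Fin 3) => Real.cos (4 * (δ ^ 2 * p.1))) :=
    Real.contDiff_cos.comp hph
  have hS : ContDiff ℝ ∞ (fun p : ℝ × EuclideanSpace ℝ (Fin 3) => vS p.2) :=
    vSL.contDiff.comp contDiff_snd
  have hC : ContDiff ℝ ∞ (fun p : ℝ × EuclideanSpace ℝ (Fin 3) => vC p.2) :=
    vCL.contDiff.comp contDiff_snd
  have hH : ContDiff ℝ ∞ (fun p : ℝ × EuclideanSpace ℝ (Fin 3) => vH p.2) :=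
    vHL.contDiff.comp contDiff_snd
  have hB : ContDiff ℝ ∞ (fun p : ℝ × EuclideanSpace ℝ (Fin 3) =>
      projB δ (Real.sin (4 * (δ ^ 2 * p.1))) (Real.cos (4 * (δ ^ 2 * p.1))) p.2) := by
    have hfun : (fun p : ℝ × EuclideanSpace ℝ (Fin 3) =>
        projB δ (Real.sin (4 * (δ ^ 2 * p.1))) (Real.cos (4 * (δ ^ 2 * p.1))) p.2) =
        fun p => (4 * δ ^ 2) • (Real.cos (4 * (δ ^ 2 * p.1)) • vS p.2 -
          Real.sin (4 * (δ ^ 2 * p.1)) • vC p.2) + (-3 : ℝ) • vH p.2 := by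
      funext p; simp [projB, linD]
    rw [hfun]
    exact (((hcos.smul hS).sub (hsin.smul hC)).const_smul (4 * δ ^ 2)).add (hH.const_smul (-3 : ℝ))
  have hfun : uncurry (pres δ) = fun p : ℝ × EuclideanSpace ℝ (Fin 3) =>
      -2⁻¹ * ⟪p.2, projB δ (Real.sin (4 * (δ ^ 2 * p.1))) (Real.cos (4 * (δ ^ 2 * p.1))) p.2⟫ := by
    funext p; rfl
  unfold IsSmoothSpaceTimeOn
  rw [hfun]
  exact (contDiff_const.mul (contDiff_snd.inner ℝ hB)).contDiffOn

/-! ### The exact solution -/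

/-- **R#1′ holds**: the ansatz velocity (8) with `u_z ≡ 0` is a classical Navier–Stokes solution on
`ℝ³ × [0,∞)` with zero force, `ν = 1`, and the pressure `pres δ`. [cite: Drazin2002, Ex. 2.19] -/
theorem isClassicalNSSolutionOn_ansatz (δ : ℝ) :
    IsClassicalNSSolutionOn (Ici 0) 1 (fun _ _ => 0) (ansatzVelocity δ (fun _ _ => 0)) (pres δ) where
  smooth_velocity := isSmoothSpaceTimeOn_ansatz δ
  smooth_pressure := isSmoothSpaceTimeOn_pres δ
  momentum t ht x := by
    have hsc : Real.sin (4 * (δ ^ 2 * t)) ^ 2 + Real.cos (4 * (δ ^ 2 * t)) ^ 2 = 1 :=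
      Real.sin_sq_add_cos_sq _
    rw [timeDerivWithin_apply,
      (hasDerivAt_ansatz δ t x).hasDerivWithinAt.derivWithin (uniqueDiffOn_Ici 0 t ht),
      gradient_pres, ansatz_slice_eq, convect_apply, (linA _ _).fderiv, linA_sq _ _ hsc,
      laplacian_clm]
    simp only [projB, FunLike.coe_add, FunLike.coe_smul, Pi.add_apply,
      Pi.smul_apply, vHL_apply]
    module
  divFree t _ := by
    rw [ansatz_slice_eq]
    exact isDivFree_linA _ _

/-- **The charitable re-typing R#1′ of Step 1 (periodicity conjunct dropped) is TRUE**: for every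
`δ < 0` there are a printed forcing (`f ≡ 0`), a viscosity, a third component `u_z` (`≡ 0`) and a
pressure such that the ansatz velocity (8) is a classical forced Navier–Stokes solution on
`ℝ³ × [0,∞)`. The object the printed argument treats is therefore a genuine exact solution — outside
the Clay (B) class (not periodic, infinite energy): the row's class is «wrong problem», not a false
lemma about fluids. [cite: Moschandreou2021, eqs. (4)–(8) l.128–159 and l.145] -/
theorem step1_noPeriodicity_holds (δ : ℝ) (_hδ : δ < 0) :
    ∃ (f : ℝ → EuclideanSpace ℝ (Fin 3) → EuclideanSpace ℝ (Fin 3)) (ν : ℝ)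
      (uz : ℝ → EuclideanSpace ℝ (Fin 3) → ℝ) (P : ℝ → EuclideanSpace ℝ (Fin 3) → ℝ),
      IsPrintedForcing δ f ∧ 0 < ν ∧
      IsClassicalNSSolutionOn (Ici 0) ν f (ansatzVelocity δ uz) P :=
  ⟨fun _ _ => 0, 1, fun _ _ => 0, pres δ, Or.inl (fun _ _ => rfl), one_pos,
    isClassicalNSSolutionOn_ansatz δ⟩

end

end Summit.NavierStokesRegularity.NavierStokesRegularity.Theorems.Moschandreou2021Salvage
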